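import Summits.NavierStokesRegularity.NavierStokesRegularity.Theorems.SqueezeCycleSingularZoom
import Summits.NavierStokesRegularity.NavierStokesRegularity.Theses.RootDecompLiouvilleHorizon
import HarnessLib

/-!
# Route `RootDecompLiouvilleHorizon`, crux G `TypeIGradientFloor` (item stmt-NavierStokesRegularity-32316):
# the Liouville-free core of the Type-I exclusion — PROVED

`TypeIGradientFloor` (G, rank 2 of the node `NavierStokesRegularity ⟸ BlowupHorizon ∧ TypeIGradientFloor ∧
NoRecordEulerianTypeII`): a maximal smooth solution of the unforced Navier–Stokes system on `ℝ³ × [0, T)`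
(classical on `[0, T)`, no smooth extension past `T`), Leray–Hopf from its rapidly decaying datum, which
blows up at the Type-I rate `‖u(t)‖∞ ≤ C/√(T − t)`, carries a GRADIENT FLOOR at the same rate: for some
`c > 0`, `(T − t)·‖∇u(t)(y)‖ ≥ c` at some point `y` at times `t` arbitrarily close to `T`.

Proof (Koch–Nadirashvili–Seregin–Šverák 2009, §6, the compactness half of the Type-I exclusion, with the
Liouville theorem replaced by the parasitic-gauge remark; Albritton–Barker 2019, §3): suppose instead that
`(T − t)‖∇u(t)‖∞ → 0` as `t ↑ T`. Since `u` does not extend, Lemarié-Rieusset's criterion gives a point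
`x₀` with `u` essentially unbounded on every backward parabolic cylinder `Q_r(T, x₀)`
(`hasSmoothExtensionPast_of_forall_exists_parabolicCylinder`). The viscosity-normalising zooms
`w_k(s, y) = c_k α u(T + c_k² β s, x₀ + c_k R y)`, `c_k = 1/(k+4) ↓ 0`, are Oseen-mild classical
solutions on growing final windows with the common rate `‖w_k(s)‖ ≤ C₁/√(−s)` (the tree's `zoom_oseen`,
`zoom_norm_le`), so along a subsequence they converge at every point of the open slab `t < 0`, TOGETHER
WITH THEIR SPATIAL GRADIENTS, to a Type-I ancient mild field `W` of the Oseen gauge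
(`exists_tendsto_of_typeI_seq_Ioo`, KNSS Lemma 6.1), and `W` is unbounded at the origin by persistence
of singularities (`zoomSeq_unbounded_at_origin`, Albritton–Barker Prop. 2.3 / Rusin–Šverák). The new
step: by the two chain rules `∇w_k(s, y) = c_k² αR ∇u(t_k, ·)`, `t_k = T + c_k² β s ↑ T`, i.e.
`‖∇w_k(s, y)‖ = (αR/(β(−s)))·(T − t_k)‖∇u(t_k)(·)‖ → 0`, so every slice of `W` has zero gradient, is
constant, and the gauge kills slice-constant elements (`IsTypeIAncientMild.eq_zero_of_slice_const`,
KNSS Remark 6.1): `W ≡ 0`, contradicting unboundedness at the origin.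

Main results: `hasSmoothExtensionPast_of_typeI_of_gradient_lt` (positive form: Type-I rate + gradient
`o(1/(T − t))` ⇒ smooth extension past `T`) and
`typeIGradientFloor_proof : Theses.RootDecompLiouvilleHorizon.TypeIGradientFloor` (the item, by name).
Def-free; axioms ⊆ {propext, Classical.choice, Quot.sound}.

Sources: [KochNadirashviliSereginSverak2009] arXiv:0709.3599 §6 (Lemma 6.1, Remark 6.1, Thm 6.2);
[AlbrittonBarker2019] §3 and Prop. 2.3; [LemarieRieusset2016] Thm 15.1 (C); Seregin 2014 lecture notes p. 113.
Lens provenance: decomp-ns lens 5, gen 22 (HOME/decomp-ns-lens-5/NODE-g22.md).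
-/

set_option linter.dupNamespace false

noncomputable section

open MeasureTheory Set Function Filter TopologicalSpace Metric
open scoped Topology NNReal ENNReal InnerProductSpace RealInnerProductSpace

namespace Summit.NavierStokesRegularity.NavierStokesRegularity.Theorems.RootDecompLiouvilleHorizonTypeIGradientFloor

open Literature.Analysis Literature.Analysis.FluidPDE
open Summit.NavierStokesRegularity.NavierStokesRegularity.Theorems

/-- **A Type-I ancient mild field whose slices have zero gradient vanishes**: each slice `W(t, ·)`,
`t < 0`, is differentiable (the class is smooth on the open slab) with `∇W(t, ·) = 0`, hence constant
(`is_const_of_fderiv_eq_zero`), and the Oseen gauge excludes the parasitic slice-constant elements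
(`IsTypeIAncientMild.eq_zero_of_slice_const`; KNSS 2009, Remark 6.1 and §1 p. 3). [cite: KochNadirashviliSereginSverak2009, Remark 6.1 (arXiv:0709.3599 p. 11)] -/
theorem eq_zero_of_fderiv_slice_eq_zero {C : ℝ}
    {W : ℝ → EuclideanSpace ℝ (Fin 3) → EuclideanSpace ℝ (Fin 3)} (hW : IsTypeIAncientMild C W)
    (hD : ∀ t < 0, ∀ x, fderiv ℝ (W t) x = 0) {t : ℝ} (ht : t < 0) (x : EuclideanSpace ℝ (Fin 3)) :
    W t x = 0 := by
  have hWd : ∀ s < 0, Differentiable ℝ (W s) := fun s hs =>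
    (hW.1.comp_contDiff (contDiff_prodMk_right s) fun x => ⟨hs, mem_univ x⟩).differentiable (by simp)
  have hub : ∀ s < 0, ∀ y, W s y = W s 0 := fun s hs y =>
    is_const_of_fderiv_eq_zero (hWd s hs) (hD s hs) y 0
  exact hW.eq_zero_of_slice_const (b := fun s => W s 0) hub ht x

variable {ν T : ℝ} {u : ℝ → EuclideanSpace ℝ (Fin 3) → EuclideanSpace ℝ (Fin 3)}
  {p : ℝ → EuclideanSpace ℝ (Fin 3) → ℝ}

/-- **Type-I rate with a sub-Type-I gradient forces a smooth extension** (the Liouville-free core of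
KNSS 2009, Thm 6.2 / §6: compactness of the Type-I zooms in the Oseen gauge + persistence of
singularities + the parasitic-gauge Remark 6.1 in place of the Liouville theorem). For `ν > 0`, `T > 0`,
a classical solution `(u, p)` on `ℝ³ × [0, T)`, Leray–Hopf from a rapidly decaying datum, with
`IsTypeIBlowup u T`: if for every `c > 0` eventually as `t ↑ T` one has `(T − t)‖∇u(t)(y)‖ < c` for all
`y`, then `u` extends smoothly past `T`. At a would-be singular point `(T, x₀)` the zooms
`c_kα u(T + c_k²βs, x₀ + c_kRy)` converge with their gradients to a Type-I ancient mild field `W`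
unbounded at the origin (`exists_tendsto_of_typeI_seq_Ioo`, `zoomSeq_unbounded_at_origin`), while
`‖∇w_k(s, y)‖ = (αR/(β(−s)))·(T − t_k)‖∇u(t_k)‖ → 0` (`fderiv_zoomIn_eq`), so `∇W ≡ 0` and `W ≡ 0`
(`eq_zero_of_fderiv_slice_eq_zero`) — a contradiction. [cite: KochNadirashviliSereginSverak2009, Lemma 6.1, Remark 6.1 and Thm 6.2 (arXiv:0709.3599 pp. 11–13); AlbrittonBarker2019, §3 and Prop. 2.3] -/
theorem hasSmoothExtensionPast_of_typeI_of_gradient_lt (hν : 0 < ν) (hT : 0 < T)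
    (hsol : IsClassicalNSSolutionOn (Ico 0 T) ν 0 u p) (hLH : IsLerayHopfOn T ν 0 (u 0) u)
    (hdec : HasRapidSpatialDecay (u 0)) (hTI : IsTypeIBlowup u T)
    (hsmall : ∀ c : ℝ, 0 < c → ∀ᶠ t in 𝓝[<] T, ∀ y : EuclideanSpace ℝ (Fin 3),
      (T - t) * ‖fderiv ℝ (u t) y‖ < c) :
    HasSmoothExtensionPast ν 0 u T := by
  refine hasSmoothExtensionPast_of_forall_exists_parabolicCylinder hν hT hsol hLH hdec fun x₀ => ?_
  by_contra hno
  push Not at hno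
  have hsing : ∀ r : ℝ, 0 < r →
      eLpNorm (uncurry u) ∞ (volume.restrict (parabolicCylinder r ((T : ℝ), x₀))) = ∞ :=
    fun r hr => top_le_iff.1 (hno r hr)
  -- ## (1) the Type-I rate window, the Morrey bound and the unit zoom at `(T, x₀)`
  obtain ⟨C, δ, -, hδ, hδT, hrate⟩ := exists_typeI_rate_window hT hTI
  obtain ⟨r₀, M₀, T₁, hr₀, hT₁, hMor⟩ := morrey_of_typeI hν hT hsol hLH hTI
  obtain ⟨R, α, β, hR, hα, hβ, hβeq, hαeq, hβT, hball, hGv, htypeI⟩ :=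
    exists_zoom_typeIBound_lt_top_of_morrey hν hT hsol hLH hr₀ hT₁ hMor x₀
  set πv : ℝ → EuclideanSpace ℝ (Fin 3) → ℝ :=
    α ^ 2 • stPull β R T x₀ (fun t x => p t x - (p t 0 - normalisedPressure (u t) 0)) with hπv
  have hI₀top : typeIBound (parabolicCylinder (1 / 2) (0 : ℝ × EuclideanSpace ℝ (Fin 3)))
      (α • stPull β R T x₀ u) πv ((α * R) • stPull β R T x₀ fun t x => fderiv ℝ (u t) x) ≠ ⊤ :=
    htypeI.ne
  -- ## (2) the scales `c k = 1/(k+4) ↓ 0` and the zoom sequence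
  set c : ℕ → ℝ := fun k => 1 / ((k : ℝ) + 4) with hc
  have hcpos : ∀ k, 0 < c k := fun k => by simp only [hc]; positivity
  have hc4 : ∀ k, c k ≤ 1 / 4 := fun k =>
    div_le_div_of_nonneg_left zero_le_one (by norm_num) (by linarith [(Nat.cast_nonneg k : (0 : ℝ) ≤ k)])
  have hc2 : ∀ k, c k ≤ 1 / 2 := fun k => (hc4 k).trans (by norm_num)
  have hclim : Tendsto c atTop (𝓝 0) :=
    tendsto_const_nhds.div_atTop (tendsto_atTop_add_const_right _ _ tendsto_natCast_atTop_atTop)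
  set w : ℕ → ℝ → EuclideanSpace ℝ (Fin 3) → EuclideanSpace ℝ (Fin 3) :=
    fun k => (c k * α) • stPull (c k ^ 2 * β) (c k * R) T x₀ u with hw
  -- the final windows `(A k, 0)`, `A k → -∞`
  set A : ℕ → ℝ := fun k => -(δ / (c k ^ 2 * β)) with hA
  have hAk : ∀ k, A k = -(δ / β * ((k : ℝ) + 4) ^ 2) := by
    intro k
    simp only [hA, hc]
    field_simp
  have hAlim : Tendsto A atTop atBot := by
    have h1 : Tendsto (fun k : ℕ => ((k : ℝ) + 4) ^ 2) atTop atTop :=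
      (tendsto_pow_atTop two_ne_zero).comp
        (tendsto_atTop_add_const_right _ _ tendsto_natCast_atTop_atTop)
    have h2 : Tendsto (fun k : ℕ => δ / β * ((k : ℝ) + 4) ^ 2) atTop atTop :=
      h1.const_mul_atTop (by positivity)
    refine (tendsto_neg_atTop_atBot.comp h2).congr fun k => ?_
    rw [hAk k]
    rfl
  -- ## (3) per-scale facts: continuity, weak divergence-freeness, the Oseen equation, the rate
  have hcW : ∀ k, ContinuousOn (uncurry (w k)) (Ioo (A k) 0 ×ˢ univ) := fun k =>
    zoom_continuousOn hν hsol hR hαeq hβeq (hcpos k) hδT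
  have hdivW : ∀ k, ∀ t ∈ Ioo (A k) 0, IsWeaklyDivFree (w k t) := fun k t ht =>
    zoom_isWeaklyDivFree hν hsol hR hαeq hβeq (hcpos k) hδT ht
  have hmildW : ∀ k, ∀ s t : ℝ, A k < s → s < t → t < 0 → ∀ y,
      w k t y = UnboundedOperators.heatExtension (w k s) (t - s) y -
        oseenDuhamel 1 s (w k) (w k) t y := fun k s t hs hst ht y =>
    zoom_oseen hν hT hsol hLH hdec hR hαeq hβeq (hcpos k) hδT hs hst ht y
  set C₁ : ℝ := α * C / Real.sqrt β with hC₁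
  have hIW : ∀ k, ∀ t ∈ Ioo (A k) 0, ∀ y, ‖w k t y‖ ≤ C₁ / Real.sqrt (-t) := fun k t ht y =>
    zoom_norm_le hR hαeq hβeq hν (hcpos k) hδT hrate ht y
  -- ## (4) extraction of the `C¹_loc` limit `W ∈ 𝒦_{C₁}` (fields AND gradients converge pointwise)
  obtain ⟨φ, hφ, W, hWclass, hpt, hptG, -, -⟩ :=
    exists_tendsto_of_typeI_seq_Ioo C₁ hAlim hcW hdivW hmildW hIW
  have hφt : Tendsto φ atTop atTop := hφ.tendsto_atTop
  have hcφ : Tendsto (fun j => c (φ j)) atTop (𝓝 0) := hclim.comp hφt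
  have hAφ : Tendsto (fun j => A (φ j)) atTop atBot := hAlim.comp hφt
  -- ## (5) `W` is unbounded at the origin (persistence of singularities)
  have hsingW : ∀ r > 0, ∀ M : ℝ, ∃ t ∈ Ioo (-(r ^ 2)) (0 : ℝ),
      ∃ x ∈ ball (0 : EuclideanSpace ℝ (Fin 3)) r, M < ‖W t x‖ :=
    zoomSeq_unbounded_at_origin (πv := πv) hsol hR hα hβ hβT hsing hball hGv hI₀top
      (fun j => hcpos (φ j)) (fun j => hc2 (φ j)) fun z hz =>
        hpt z.1 ((SuitableCompactness.mem_parabolicCylinder_zero.1 hz).1.2) z.2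
  -- ## (6) the new step: every slice of `W` has zero gradient
  have hαR : 0 < α * R := mul_pos hα hR
  have hDW : ∀ s < 0, ∀ y, fderiv ℝ (W s) y = 0 := by
    intro s hs y
    have hs' : 0 < -s := neg_pos.2 hs
    have hbs : 0 < β * (-s) := mul_pos hβ hs'
    refine tendsto_nhds_unique (hptG s hs y) ?_
    rw [NormedAddGroup.tendsto_nhds_zero]
    intro ε hε
    -- the physical times `t_j = T + β c_j² s ↑ T`
    have htT : Tendsto (fun j => T + β * (c (φ j) ^ 2 * s)) atTop (𝓝[<] T) := by
      refine tendsto_nhdsWithin_iff.2 ⟨?_, Eventually.of_forall fun j => ?_⟩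
      · have h : Tendsto (fun j => T + β * (c (φ j) ^ 2 * s)) atTop
            (𝓝 (T + β * (0 ^ 2 * s))) :=
          (((hcφ.pow 2).mul_const s).const_mul β).const_add T
        rwa [zero_pow two_ne_zero, zero_mul, mul_zero, add_zero] at h
      · have h1 : 0 < β * (c (φ j) ^ 2 * (-s)) := mul_pos hβ (mul_pos (pow_pos (hcpos _) 2) hs')
        show T + β * (c (φ j) ^ 2 * s) < T
        nlinarith [h1]
    have e1 := htT.eventually (hsmall (ε * (β * (-s)) / (α * R)) (div_pos (mul_pos hε hbs) hαR))
    have e2 : ∀ᶠ j in atTop, A (φ j) < s := hAφ.eventually (eventually_lt_atBot s)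
    filter_upwards [e1, e2] with j hj1 hj2
    have hsj : s ∈ Ioo (-(δ / (c (φ j) ^ 2 * β))) 0 := ⟨hj2, hs⟩
    -- the zoomed gradient is the gradient of the zoom (two chain rules)
    have key : fderiv ℝ (w (φ j) s) y =
        c (φ j) ^ 2 • ((α * R) •
          fderiv ℝ (u (T + β * (c (φ j) ^ 2 * s))) (x₀ + R • (c (φ j) • y))) := by
      show fderiv ℝ (((c (φ j) * α) • stPull (c (φ j) ^ 2 * β) (c (φ j) * R) T x₀ u) s) y = _
      rw [zoom_eq_zoomIn, ← fderiv_zoomIn_eq hsol hβ hδT (hcpos (φ j)) hsj y]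
      show c (φ j) ^ 2 • ((α * R) •
          fderiv ℝ (u (T + β * (0 + c (φ j) ^ 2 * s))) (x₀ + R • (0 + c (φ j) • y))) = _
      rw [zero_add, zero_add]
    -- the hypothesis at the physical time `t_j` and point `x₀ + c_j R y`
    have h0 : (T - (T + β * (c (φ j) ^ 2 * s))) *
        ‖fderiv ℝ (u (T + β * (c (φ j) ^ 2 * s))) (x₀ + R • (c (φ j) • y))‖ <
          ε * (β * (-s)) / (α * R) := hj1 _
    rw [show T - (T + β * (c (φ j) ^ 2 * s)) = c (φ j) ^ 2 * (β * (-s)) by ring,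
      lt_div_iff₀ hαR] at h0
    rw [key, norm_smul, norm_smul, Real.norm_eq_abs, Real.norm_eq_abs,
      abs_of_pos (pow_pos (hcpos (φ j)) 2), abs_of_pos hαR]
    refine lt_of_mul_lt_mul_right ?_ hbs.le
    calc c (φ j) ^ 2 * (α * R *
          ‖fderiv ℝ (u (T + β * (c (φ j) ^ 2 * s))) (x₀ + R • (c (φ j) • y))‖) * (β * (-s))
        = c (φ j) ^ 2 * (β * (-s)) *
          ‖fderiv ℝ (u (T + β * (c (φ j) ^ 2 * s))) (x₀ + R • (c (φ j) • y))‖ * (α * R) := by ring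
      _ < ε * (β * (-s)) := h0
  -- ## (7) contradiction: `W ≡ 0` is not unbounded at the origin
  obtain ⟨t, ht, x, -, hM⟩ := hsingW 1 one_pos 0
  rw [eq_zero_of_fderiv_slice_eq_zero hWclass hDW ht.2 x, norm_zero] at hM
  exact lt_irrefl _ hM

/-- **`TypeIGradientFloor` (item stmt-NavierStokesRegularity-32316, crux G of route
`RootDecompLiouvilleHorizon`) holds**: a maximal smooth solution on `[0, T)` — classical with no smooth
extension past `T` — which is Leray–Hopf from a rapidly decaying datum and blows up at the Type-I rate
has a gradient floor `(T − t)‖∇u(t)(y)‖ ≥ c > 0` at some point at times arbitrarily close to `T`;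
otherwise `(T − t)‖∇u(t)‖∞ → 0` along `t ↑ T` and `hasSmoothExtensionPast_of_typeI_of_gradient_lt`
contradicts maximality. [cite: KochNadirashviliSereginSverak2009, §6 Thm 6.2 (arXiv:0709.3599 p. 13); AlbrittonBarker2019, §3] -/
theorem typeIGradientFloor_proof :
    Summit.NavierStokesRegularity.NavierStokesRegularity.Theses.RootDecompLiouvilleHorizon.TypeIGradientFloor := by
  intro ν T hν hT u p hmax hLH hdec hTI
  by_contra hG
  simp only [not_exists, not_and, not_frequently, not_le] at hG
  exact hmax.2 (hasSmoothExtensionPast_of_typeI_of_gradient_lt hν hT hmax.1 hLH hdec hTI hG)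

end Summit.NavierStokesRegularity.NavierStokesRegularity.Theorems.RootDecompLiouvilleHorizonTypeIGradientFloor

end
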